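import Literature.Barriers.PneNP.TSPExtensionComplexity
import HarnessLib

/-!
# Extended formulations give rectangle covers of the slack support (Yannakakis, duality-free)

Support file for the discharge of `Literature.Barriers.PneNP.TSPExtensionComplexity` (FMPTW
2015, Thm. 12). The printed route from an extended formulation (EF) of size `r` to a covering of
the support of a slack matrix by `r` rectangles is Yannakakis' factorization theorem (FMPTW
Thm. 3, whose proof uses Farkas' lemma, FMPTW Lemma 2) followed by "nonnegative rank ≥ rectangle
covering bound" (FMPTW Thm. 4); Kaibel–Weltge (Lemma 2) use instead that every face of a
polyhedron is the intersection of the facets containing it. Mathlib (v4.32) has neither the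
polyhedral Farkas lemma nor facet theory, so we prove the covering statement DIRECTLY from the
EF by an elementary perturbation argument (same conclusion, one extra rectangle for the rows that
are never tight):

Let `Q̂ = {(x,y) : E x + F y = g, y ≥ 0}` project onto `P`, let `v_b ∈ P` be points and
`c_a · x ≤ d_a` valid inequalities. Put `T_a = {(x,y) ∈ Q̂ : c_a · x = d_a}`,
`RA_j = {a : y_j = 0 on T_a}`, `RB_j = {b : some lift (v_b, y) ∈ Q̂ has y_j > 0}` (`j < r`),
and `RA_* = {a : never tight on P}`, `RB_* = everything`.
* `RA_j × RB_j` lies in the support: a lift of `v_b` with `y_j > 0` is not in `T_a`, so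
  `c_a · v_b ≠ d_a`.
* Cover: if `c_a · v_b < d_a`, `a` is tight somewhere, and no `j` works, then for every `j` in
  the support of a lift `y⁰` of `v_b` there is a point of `T_a` with `y_j > 0`; averaging
  (midpoints) gives `(x*, y*) ∈ T_a` positive on `supp y⁰`, and then
  `(1+t)(x*,y*) - t(v_b, y⁰) ∈ Q̂` for small `t > 0` has `c_a · x = d_a + t (d_a - c_a · v_b) > d_a`,
  contradicting validity.

Downstream this is combined with the Kaibel–Weltge bound
(`TSPExtensionComplexityKaibelWeltge.lean`): a unique-disjointness slack pattern on
`2^[n] × 2^[n]` then forces `3^n ≤ (r + 1) · 2^n`. All proved.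

Sources: [FioriniEtAl2015] Thms. 3, 4 (PDF pp. 8–9); [KaibelWeltge2014] Lemma 2, Thm. 1
(PDF p. 4); [Yannakakis1991] (through both).
-/

noncomputable section

namespace Literature.Barriers.PneNP

open Matrix Finset

variable {ι : Type} [Fintype ι] {r : ℕ}

/-- Affine combinations (weights summing to `1`) of solutions of `E x + F y = g` are solutions.
[folklore] -/
theorem ExtendedFormulation.eq_combo (Q : ExtendedFormulation ι r) {x x' : ι → ℝ}
    {y y' : Fin r → ℝ} (h : Q.E *ᵥ x + Q.F *ᵥ y = Q.g) (h' : Q.E *ᵥ x' + Q.F *ᵥ y' = Q.g)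
    (s t : ℝ) (hst : s + t = 1) :
    Q.E *ᵥ (s • x + t • x') + Q.F *ᵥ (s • y + t • y') = Q.g := by
  rw [mulVec_add, mulVec_add, mulVec_smul, mulVec_smul, mulVec_smul, mulVec_smul]
  calc s • Q.E *ᵥ x + t • Q.E *ᵥ x' + (s • Q.F *ᵥ y + t • Q.F *ᵥ y')
        = s • (Q.E *ᵥ x + Q.F *ᵥ y) + t • (Q.E *ᵥ x' + Q.F *ᵥ y') := by
          rw [smul_add, smul_add]; abel
    _ = Q.g := by rw [h, h', ← add_smul, hst, one_smul]

/-- **EF ⇒ rectangle cover of the slack support (Yannakakis' bound, duality-free form).**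
Let `P` have an extended formulation of size `r`, let `v b ∈ P` be points and `c a · x ≤ d a`
inequalities valid on `P`. Then there are a set `RA₀` of rows and `r` rectangles
`RA j × RB j` such that: every row in `RA₀` has positive slack against every `v b`; every
rectangle consists of positive-slack entries; and every positive-slack entry `(a, b)` has
`a ∈ RA₀` or lies in some rectangle. (Printed route: factorization theorem + support of a
nonnegative factorization; here proved directly, see the module docstring.)
[cite: FioriniEtAl2015, Thm. 3 and Thm. 4 (PDF pp. 8–9)] -/
theorem HasEFOfSize.exists_cover {P : Set (ι → ℝ)} (h : HasEFOfSize P r) {A B : Type*}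
    (v : B → ι → ℝ) (hv : ∀ b, v b ∈ P) (c : A → ι → ℝ) (d : A → ℝ)
    (hvalid : ∀ a, ∀ x ∈ P, c a ⬝ᵥ x ≤ d a) :
    ∃ (RA₀ : Set A) (RA : Fin r → Set A) (RB : Fin r → Set B),
      (∀ a ∈ RA₀, ∀ b, c a ⬝ᵥ v b < d a) ∧
      (∀ j, ∀ a ∈ RA j, ∀ b ∈ RB j, c a ⬝ᵥ v b < d a) ∧
      (∀ a b, c a ⬝ᵥ v b < d a → a ∈ RA₀ ∨ ∃ j, a ∈ RA j ∧ b ∈ RB j) := by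
  classical
  obtain ⟨Q, hQ⟩ := h
  -- the tight lifted points of row `a`
  let T : A → Set ((ι → ℝ) × (Fin r → ℝ)) := fun a =>
    {z | ((∀ j, 0 ≤ z.2 j) ∧ Q.E *ᵥ z.1 + Q.F *ᵥ z.2 = Q.g) ∧ c a ⬝ᵥ z.1 = d a}
  let RA₀ : Set A := {a | ∀ x ∈ P, c a ⬝ᵥ x ≠ d a}
  let RA : Fin r → Set A := fun j => {a | ∀ z ∈ T a, z.2 j = 0}
  let RB : Fin r → Set B := fun j =>
    {b | ∃ y : Fin r → ℝ, ((∀ j, 0 ≤ y j) ∧ Q.E *ᵥ v b + Q.F *ᵥ y = Q.g) ∧ 0 < y j}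
  refine ⟨RA₀, RA, RB, ?_, ?_, ?_⟩
  · intro a ha b
    exact lt_of_le_of_ne (hvalid a _ (hv b)) (ha _ (hv b))
  · intro j a ha b hb
    obtain ⟨y, hy, hyj⟩ := hb
    refine lt_of_le_of_ne (hvalid a _ (hv b)) fun heq => ?_
    have h0 : y j = 0 := ha (v b, y) ⟨hy, heq⟩
    exact hyj.ne' h0
  · intro a b hab
    by_cases hnone : ∀ x ∈ P, c a ⬝ᵥ x ≠ d a
    · exact Or.inl hnone
    right
    push Not at hnone
    obtain ⟨x₀, hx₀P, hx₀⟩ := hnone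
    by_contra hno
    push Not at hno
    -- a lift of `v b` and a tight lifted point
    obtain ⟨y₀, hy₀⟩ : v b ∈ Q.projSet := by rw [hQ]; exact hv b
    obtain ⟨w₀, hw₀⟩ : x₀ ∈ Q.projSet := by rw [hQ]; exact hx₀P
    -- averaging: a tight point positive wherever `y₀` is
    have key : ∀ S : Finset (Fin r), ∃ z ∈ T a, ∀ j ∈ S, 0 < y₀ j → 0 < z.2 j := by
      intro S
      induction S using Finset.induction_on with
      | empty => exact ⟨(x₀, w₀), ⟨hw₀, hx₀⟩, by simp⟩
      | insert j S hj ih =>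
        obtain ⟨z, hzT, hz⟩ := ih
        by_cases hyj : 0 < y₀ j
        · have hb : b ∈ RB j := ⟨y₀, hy₀, hyj⟩
          have ha : a ∉ RA j := fun ha => hno j ha hb
          simp only [RA, Set.mem_setOf_eq] at ha
          push Not at ha
          obtain ⟨z', hz'T, hz'j⟩ := ha
          refine ⟨((1 / 2 : ℝ) • z.1 + (1 / 2 : ℝ) • z'.1, (1 / 2 : ℝ) • z.2 + (1 / 2 : ℝ) • z'.2),
            ⟨⟨fun i => ?_, Q.eq_combo hzT.1.2 hz'T.1.2 _ _ (by norm_num)⟩, ?_⟩, ?_⟩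
          · simp only [Pi.add_apply, Pi.smul_apply, smul_eq_mul]
            have h1 := hzT.1.1 i
            have h2 := hz'T.1.1 i
            positivity
          · show c a ⬝ᵥ ((1 / 2 : ℝ) • z.1 + (1 / 2 : ℝ) • z'.1) = d a
            rw [dotProduct_add, dotProduct_smul, dotProduct_smul, hzT.2, hz'T.2, smul_eq_mul]
            ring
          · intro i hi hyi
            simp only [Pi.add_apply, Pi.smul_apply, smul_eq_mul]
            rcases Finset.mem_insert.1 hi with rfl | hi
            · have h1 := hzT.1.1 i
              have h2 : 0 < z'.2 i := lt_of_le_of_ne (hz'T.1.1 i) (Ne.symm hz'j)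
              linarith
            · have h1 := hz i hi hyi
              have h2 := hz'T.1.1 i
              linarith
        · refine ⟨z, hzT, fun i hi hyi => ?_⟩
          rcases Finset.mem_insert.1 hi with rfl | hi
          · exact absurd hyi hyj
          · exact hz i hi hyi
    obtain ⟨z, hzT, hzpos⟩ := key Finset.univ
    -- the step size
    let q : Fin r → ℝ := fun i => y₀ i / z.2 i
    let t : ℝ := (1 + ∑ i, q i)⁻¹
    have hq : ∀ i, 0 ≤ q i := fun i => div_nonneg (hy₀.1 i) (hzT.1.1 i)
    have hqs : 0 ≤ ∑ i, q i := Finset.sum_nonneg fun i _ => hq i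
    have ht : 0 < t := by positivity
    have hty : ∀ i, t * y₀ i ≤ z.2 i := by
      intro i
      by_cases hyi : 0 < y₀ i
      · have hzi : 0 < z.2 i := hzpos i (Finset.mem_univ _) hyi
        have hqi : 0 < q i := div_pos hyi hzi
        have hsum : q i ≤ 1 + ∑ k, q k := by
          have := Finset.single_le_sum (fun k _ => hq k) (Finset.mem_univ i)
          linarith
        calc t * y₀ i = y₀ i / (1 + ∑ k, q k) := by rw [inv_mul_eq_div]
          _ ≤ y₀ i / q i := div_le_div_of_nonneg_left (hy₀.1 i) hqi hsum
          _ = z.2 i := by rw [div_div_eq_mul_div, mul_div_cancel_left₀ _ hyi.ne']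
      · have h0 : y₀ i = 0 := le_antisymm (not_lt.1 hyi) (hy₀.1 i)
        rw [h0, mul_zero]
        exact hzT.1.1 i
    -- the perturbed point `(1 + t) z - t (v b, y₀)` is feasible but violates validity
    have hfeas : (∀ j, 0 ≤ ((1 + t) • z.2 + (-t) • y₀) j) ∧
        Q.E *ᵥ ((1 + t) • z.1 + (-t) • v b) + Q.F *ᵥ ((1 + t) • z.2 + (-t) • y₀) = Q.g := by
      refine ⟨fun i => ?_, Q.eq_combo hzT.1.2 hy₀.2 _ _ (by ring)⟩
      simp only [Pi.add_apply, Pi.smul_apply, smul_eq_mul]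
      have h1 := hty i
      have h2 := hzT.1.1 i
      nlinarith
    have hxP : (1 + t) • z.1 + (-t) • v b ∈ P := by
      rw [← hQ]
      exact ⟨_, hfeas⟩
    have hle := hvalid a _ hxP
    rw [dotProduct_add, dotProduct_smul, dotProduct_smul, hzT.2, smul_eq_mul, smul_eq_mul] at hle
    have hpos : 0 < t * (d a - c a ⬝ᵥ v b) := mul_pos ht (by linarith)
    nlinarith

/-- The same cover indexed by `Option (Fin r)` (`none` = the never-tight rows times everything):
`r + 1` rectangles inside the positive-slack support that cover it.
[cite: FioriniEtAl2015, Thm. 3 and Thm. 4 (PDF pp. 8–9)] -/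
theorem HasEFOfSize.exists_cover_option {P : Set (ι → ℝ)} (h : HasEFOfSize P r) {A B : Type*}
    (v : B → ι → ℝ) (hv : ∀ b, v b ∈ P) (c : A → ι → ℝ) (d : A → ℝ)
    (hvalid : ∀ a, ∀ x ∈ P, c a ⬝ᵥ x ≤ d a) :
    ∃ (RA : Option (Fin r) → Set A) (RB : Option (Fin r) → Set B),
      (∀ j, ∀ a ∈ RA j, ∀ b ∈ RB j, c a ⬝ᵥ v b < d a) ∧
      (∀ a b, c a ⬝ᵥ v b < d a → ∃ j, a ∈ RA j ∧ b ∈ RB j) := by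
  obtain ⟨RA₀, RA, RB, h0, h1, h2⟩ := h.exists_cover v hv c d hvalid
  refine ⟨fun o => o.elim RA₀ RA, fun o => o.elim Set.univ RB, ?_, ?_⟩
  · rintro (_ | j) a ha b hb
    · exact h0 a ha b
    · exact h1 j a ha b hb
  · intro a b hab
    rcases h2 a b hab with ha | ⟨j, ha, hb⟩
    · exact ⟨none, ha, Set.mem_univ _⟩
    · exact ⟨some j, ha, hb⟩

end Literature.Barriers.PneNP

end
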